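import Summits.Langlands.Langlands.Theses.GaloisWeightedBE
import Literature.NumberTheory.LFunctions.RHWave0GRHProofs
import HarnessLib

/-!
# Birth skeleton — piece X₁ `GeneralizedRiemannHypothesis` (BY NAME) of the decomposition of crux #4
# `ExtendedRiemannHypothesis` (route GaloisWeightedBE, parent crux stmt-Langlands-14565; strategist
# planner-cstrat-stmt-Langlands-14565-r1-0, v2)

The piece is the tree's conjecture constant `Literature.NumberTheory.LFunctions.GeneralizedRiemannHypothesis`
(GRH for all Dirichlet `L`-functions, open strip; PROVED equivalent to ERH for abelian number fields in the line
files, by Kronecker–Weber). Its two leaves are NAMED classical statements — RH itself (Mathlib `RiemannHypothesis`,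
the RH summit) and GRH for the non-principal primitive characters — composed through the tree's reduction to
primitive characters (`generalizedRiemannHypothesis_iff_isPrimitive`) and `L(s, 1 mod 1) = ζ`
(`riemannHypothesisStrip_iff_forall_dirichletCharacter_one`, `riemannHypothesis_iff_strip_holds`). The seam is
the case split "principal / non-principal" on primitive characters (flag: trivial_seam — both leaves are named
conjectures, not carvings). Sorries ONLY inside `stub_*`.
-/

noncomputable section

namespace Summit.Langlands.Langlands.Cruxes.ExtendedRiemannHypothesis.BirthGeneralizedRiemannHypothesis

open Literature.NumberTheory.LFunctions

/-- The piece, BY NAME. -/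
def GRHDirichlet : Prop := Literature.NumberTheory.LFunctions.GeneralizedRiemannHypothesis

/-- **stub_riemannHypothesis** (OPEN): Mathlib's `RiemannHypothesis` (= `Summit.RiemannHypothesis`). [cite: Bombieri2000, §I] -/
theorem stub_riemannHypothesis : RiemannHypothesis := by
  sorry

/-- **stub_grhNonprincipalPrimitive** (OPEN): GRH (open strip) for every non-principal primitive Dirichlet
character. [cite: MontgomeryVaughan2007, §10.1] -/
theorem stub_grhNonprincipalPrimitive : ∀ (N : ℕ) [NeZero N] (χ : DirichletCharacter ℂ N),
    χ.IsPrimitive → χ ≠ 1 → χ.RiemannHypothesis := by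
  sorry

/-- **COMPOSITION** (kernel-checked, sorry-free): GRH for Dirichlet `L`-functions from RH (by name,
Mathlib `RiemannHypothesis` = the RH summit) and GRH for the NON-PRINCIPAL PRIMITIVE characters, through the
tree's reduction to primitive characters (`generalizedRiemannHypothesis_iff_isPrimitive`) and `L(s, 1 mod 1) = ζ`
(`riemannHypothesisStrip_iff_forall_dirichletCharacter_one`, `riemannHypothesis_iff_strip_holds`). [folklore] -/
theorem GRHDirichlet_of :
    RiemannHypothesis →
    (∀ (N : ℕ) [NeZero N] (χ : DirichletCharacter ℂ N), χ.IsPrimitive → χ ≠ 1 → χ.RiemannHypothesis) →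
    GRHDirichlet := by
  intro hRH h
  refine generalizedRiemannHypothesis_iff_isPrimitive.mpr fun N _ χ hprim => ?_
  by_cases h1 : χ = 1
  · subst h1
    have hN : N = 1 :=
      (show (1 : DirichletCharacter ℂ N).conductor = N from hprim).symm.trans
        DirichletCharacter.conductor_one
    subst hN
    exact riemannHypothesisStrip_iff_forall_dirichletCharacter_one.mp
      (riemannHypothesis_iff_strip_holds.mp hRH) 1
  · exact h N χ hprim h1

/-- Registered (closed) form. [folklore] -/
theorem GRHDirichlet_from_stubs : GRHDirichlet :=
  GRHDirichlet_of stub_riemannHypothesis stub_grhNonprincipalPrimitive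

/-- Sanity (BC5-style special case): the piece CONTAINS leaf 1 (GRH ⇒ RH, tree). [folklore] -/
theorem riemannHypothesis_of_GRHDirichlet (h : GRHDirichlet) : RiemannHypothesis :=
  GeneralizedRiemannHypothesis.riemannHypothesis h

end Summit.Langlands.Langlands.Cruxes.ExtendedRiemannHypothesis.BirthGeneralizedRiemannHypothesis

end
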